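import Literature.MathematicalPhysics.KineticTheory.HardSphereEulerLLN

/-!
# Tilted density profiles and the exponential Chebyshev bound for the canonical hard-sphere gas

Helper file for the support item `UniformLocalGibbsConcentration` (routes `OneFlightGossipEngine`, `TwoClocks`)
(stmt-AtomisticToContinuum-14445). For a density profile `P` on `𝕋³`, a continuous `χ` and
`t ∈ ℝ`, the **tilted profile** `β_t = β e^{tχ} / Z_t`, `Z_t = ∫ β e^{tχ}`, is again a density
profile (`exists_tilt`), with `Q.M ≤ P.M e^{2|t|C}` and `|β_t - β| ≤ P.M (e^{2|t|C} - 1)` for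
`|χ| ≤ C` (`tilt_M_le`, `abs_tilt_sub_le`). Under the product law `μ_P^{⊗n}` restricted to the
hard-core set, tilting the empirical sum `S = ∑ᵢ χ(xᵢ)` is the same as passing to the tilted
profile: `Z_tⁿ Ξ_Q(n) = ∫ e^{tS} 𝟙_H dμ_P^{⊗n}` and `Z_tⁿ M^χ_Q(n) = ∫ χ(x₀) e^{tS} 𝟙_H dμ_P^{⊗n}`
(`pow_mul_Xi_tilt`, `pow_mul_Md_tilt`), and `∫ S e^{tS} 𝟙_H = n ∫ χ(x₀) e^{tS} 𝟙_H`
(exchangeability, `integral_sum_mul_eq`). With the elementary Gibbs inequality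
`∫ e^f dρ ≤ ρ(univ) · exp(∫ f e^f / ∫ e^f)` (`integral_exp_le`, from `e^y ≥ 1 + y`) and Markov's
inequality this gives the **one-sided exponential Chebyshev bound**
`Ξ_P(n)⁻¹ μ_P^{⊗n}|_H {n a ≤ S} ≤ exp(n t (E_{Q_t}[χ(x₀)] - a))` (`canonical_tail_le`), where
`E_{Q}[χ(x₀)] = M^χ_Q(n) / Ξ_Q(n)` is the one-point expectation of the tilted canonical gas
(`onePt Q σ χ N 0` of `HardSphereEulerLLN` along the hydrodynamic scaling).
-/

noncomputable section

namespace Summit.AtomisticToContinuum.HydrodynamicLimit.Theorems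

namespace UniformLGC

open MeasureTheory Filter Set Topology Finset
open Literature.MathematicalPhysics.KineticTheory Literature.MathematicalPhysics.StatisticalMechanics

/-! ### The tilted profile -/

section TiltProfile

variable (P : DensityProfile) {χ : T3 → ℝ}

/-- **The tilted profile exists**: `β_t = β e^{tχ} / ∫ β e^{tχ}` is a density profile. -/
theorem exists_tilt (hχ : Continuous χ) (t : ℝ) :
    ∃ Q : DensityProfile, ∀ x, Q.β x = P.β x * Real.exp (t * χ x) / ∫ y, P.β y * Real.exp (t * χ y) := by
  have hcont : Continuous fun y => P.β y * Real.exp (t * χ y) :=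
    P.continuous.mul (Real.continuous_exp.comp (continuous_const.mul hχ))
  have hpos : ∀ y, 0 < P.β y * Real.exp (t * χ y) := fun y => mul_pos (P.pos y) (Real.exp_pos _)
  have hZ : 0 < ∫ y, P.β y * Real.exp (t * χ y) := integral_pos_of_continuous_pos hcont hpos
  exact ⟨⟨fun x => P.β x * Real.exp (t * χ x) / ∫ y, P.β y * Real.exp (t * χ y), hcont.div_const _,
    fun y => div_pos (hpos y) hZ, by rw [integral_div, div_self hZ.ne']⟩, fun x => rfl⟩

variable {P} {C t : ℝ}

/-- The tilting weights are pinched: `e^{-|t|C} ≤ e^{tχ(y)} ≤ e^{|t|C}` for `|χ| ≤ C`. -/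
theorem exp_mul_mem_Icc (hχC : ∀ y, |χ y| ≤ C) (y : T3) :
    Real.exp (t * χ y) ∈ Icc (Real.exp (-(|t| * C))) (Real.exp (|t| * C)) := by
  have h : |t * χ y| ≤ |t| * C := by rw [abs_mul]; exact mul_le_mul_of_nonneg_left (hχC y) (abs_nonneg t)
  rw [abs_le] at h
  exact ⟨Real.exp_le_exp.2 h.1, Real.exp_le_exp.2 h.2⟩

/-- The tilt normalisation is pinched: `e^{-|t|C} ≤ Z_t ≤ e^{|t|C}` (`∫ β = 1`). -/
theorem tiltNorm_mem_Icc (hχ : Continuous χ) (hχC : ∀ y, |χ y| ≤ C) :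
    (∫ y, P.β y * Real.exp (t * χ y)) ∈ Icc (Real.exp (-(|t| * C))) (Real.exp (|t| * C)) := by
  have hcont : Continuous fun y => P.β y * Real.exp (t * χ y) :=
    P.continuous.mul (Real.continuous_exp.comp (continuous_const.mul hχ))
  have hint := integrable_of_continuous_T3 hcont
  have hβint := integrable_of_continuous_T3 P.continuous
  constructor
  · calc Real.exp (-(|t| * C)) = ∫ y, P.β y * Real.exp (-(|t| * C)) := by
          rw [integral_mul_const, P.integral_eq_one, one_mul]
      _ ≤ ∫ y, P.β y * Real.exp (t * χ y) :=
          integral_mono (hβint.mul_const _) hint fun y =>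
            mul_le_mul_of_nonneg_left (exp_mul_mem_Icc hχC y).1 (P.pos y).le
  · calc (∫ y, P.β y * Real.exp (t * χ y)) ≤ ∫ y, P.β y * Real.exp (|t| * C) :=
          integral_mono hint (hβint.mul_const _) fun y =>
            mul_le_mul_of_nonneg_left (exp_mul_mem_Icc hχC y).2 (P.pos y).le
      _ = Real.exp (|t| * C) := by rw [integral_mul_const, P.integral_eq_one, one_mul]

/-- The tilting ratio `e^{tχ}/Z_t` lies in `[e^{-2|t|C}, e^{2|t|C}]`. -/
theorem tiltRatio_mem_Icc (hχ : Continuous χ) (hχC : ∀ y, |χ y| ≤ C) (y : T3) :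
    Real.exp (t * χ y) / (∫ y, P.β y * Real.exp (t * χ y)) ∈
      Icc (Real.exp (-(2 * |t| * C))) (Real.exp (2 * |t| * C)) := by
  obtain ⟨hZ1, hZ2⟩ := tiltNorm_mem_Icc (P := P) (t := t) hχ hχC
  obtain ⟨he1, he2⟩ := exp_mul_mem_Icc (t := t) hχC y
  have hZ0 : 0 < ∫ y, P.β y * Real.exp (t * χ y) := (Real.exp_pos _).trans_le hZ1
  constructor
  · rw [le_div_iff₀ hZ0]
    calc Real.exp (-(2 * |t| * C)) * ∫ y, P.β y * Real.exp (t * χ y)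
        ≤ Real.exp (-(2 * |t| * C)) * Real.exp (|t| * C) :=
          mul_le_mul_of_nonneg_left hZ2 (Real.exp_pos _).le
      _ = Real.exp (-(|t| * C)) := by rw [← Real.exp_add]; ring_nf
      _ ≤ Real.exp (t * χ y) := he1
  · rw [div_le_iff₀ hZ0]
    calc Real.exp (t * χ y) ≤ Real.exp (|t| * C) := he2
      _ = Real.exp (2 * |t| * C) * Real.exp (-(|t| * C)) := by rw [← Real.exp_add]; ring_nf
      _ ≤ Real.exp (2 * |t| * C) * ∫ y, P.β y * Real.exp (t * χ y) :=
          mul_le_mul_of_nonneg_left hZ1 (Real.exp_pos _).le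

variable {Q : DensityProfile}

/-- **Sup of the tilted profile**: `Q.M ≤ P.M e^{2|t|C}`. -/
theorem tilt_M_le (hχ : Continuous χ) (hχC : ∀ y, |χ y| ≤ C)
    (hQ : ∀ x, Q.β x = P.β x * Real.exp (t * χ x) / ∫ y, P.β y * Real.exp (t * χ y)) :
    Q.M ≤ P.M * Real.exp (2 * |t| * C) := by
  refine csSup_le (Set.range_nonempty _) ?_
  rintro _ ⟨x, rfl⟩
  rw [hQ x, mul_div_assoc]
  exact mul_le_mul (P.le_M x) (tiltRatio_mem_Icc hχ hχC x).2
    (div_nonneg (Real.exp_pos _).le ((Real.exp_pos _).le.trans (tiltNorm_mem_Icc hχ hχC).1)) P.M_pos.le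

/-- **The tilted profile is uniformly close**: `|β_t(x) - β(x)| ≤ P.M (e^{2|t|C} - 1)`. -/
theorem abs_tilt_sub_le (hχ : Continuous χ) (hχC : ∀ y, |χ y| ≤ C)
    (hQ : ∀ x, Q.β x = P.β x * Real.exp (t * χ x) / ∫ y, P.β y * Real.exp (t * χ y)) (x : T3) :
    |Q.β x - P.β x| ≤ P.M * (Real.exp (2 * |t| * C) - 1) := by
  set r := Real.exp (t * χ x) / ∫ y, P.β y * Real.exp (t * χ y) with hr
  obtain ⟨hr1, hr2⟩ := tiltRatio_mem_Icc (P := P) (t := t) hχ hχC x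
  have heq : Q.β x - P.β x = P.β x * (r - 1) := by rw [hQ x, hr]; ring
  rw [heq, abs_mul, abs_of_pos (P.pos x)]
  refine mul_le_mul (P.le_M x) ?_ (abs_nonneg _) P.M_pos.le
  -- `|r - 1| ≤ e^a - 1` for `r ∈ [e^{-a}, e^a]`, since `e^a + e^{-a} ≥ 2`
  have h1 := Real.add_one_le_exp (2 * |t| * C)
  have h2 := Real.add_one_le_exp (-(2 * |t| * C))
  rw [abs_le]
  constructor <;> linarith

end TiltProfile

/-! ### Tilting the empirical sum = tilting the profile -/

section TiltIdentity

variable {P Q : DensityProfile} {χ : T3 → ℝ} {t : ℝ} (ε : ℝ) {n : ℕ}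

/-- The product of the tilted densities: `∏ β_t(yᵢ) = Z_t^{-n} e^{t ∑ χ(yᵢ)} ∏ β(yᵢ)`. -/
theorem prod_tilt_eq (hQ : ∀ x, Q.β x = P.β x * Real.exp (t * χ x) / ∫ y, P.β y * Real.exp (t * χ y))
    (y : Fin n → T3) :
    ∏ i, Q.β (y i) = ((∫ y, P.β y * Real.exp (t * χ y)) ^ n)⁻¹ *
      (Real.exp (t * ∑ i, χ (y i)) * ∏ i, P.β (y i)) := by
  simp_rw [hQ]
  rw [prod_div_distrib, prod_mul_distrib, prod_const, card_univ, Fintype.card_fin, mul_sum, Real.exp_sum]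
  ring

/-- **Tilted partition function**: `Z_tⁿ Ξ_Q(n) = ∫ e^{tS} 𝟙_H dμ_P^{⊗n}`. -/
theorem pow_mul_Xi_tilt (hχ : Continuous χ)
    (hQ : ∀ x, Q.β x = P.β x * Real.exp (t * χ x) / ∫ y, P.β y * Real.exp (t * χ y)) :
    (∫ y, P.β y * Real.exp (t * χ y)) ^ n * Xi Q ε n n =
      ∫ x, Real.exp (t * ∑ i, χ (x i)) * efR (Ov ε) x univ ∂Measure.pi fun _ : Fin n => P.μ := by
  have hZ : 0 < ∫ y, P.β y * Real.exp (t * χ y) :=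
    integral_pos_of_continuous_pos (P.continuous.mul (Real.continuous_exp.comp (continuous_const.mul hχ)))
      (fun y => mul_pos (P.pos y) (Real.exp_pos _))
  rw [Xi, firstLabels_self, ← integral_efR Q.μ (measurableSet_ov ε), integral_pi_μ, integral_pi_μ]
  have h1 : ∀ y : Fin n → T3, (∏ i, Q.β (y i)) * efR (Ov ε) y univ =
      ((∫ y, P.β y * Real.exp (t * χ y)) ^ n)⁻¹ *
        ((∏ i, P.β (y i)) * (Real.exp (t * ∑ i, χ (y i)) * efR (Ov ε) y univ)) := by
    intro y; rw [prod_tilt_eq hQ]; ring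
  simp_rw [h1]
  rw [integral_const_mul, ← mul_assoc, mul_inv_cancel₀ (pow_ne_zero n hZ.ne'), one_mul]

/-- The tilted hard-core weight `e^{tS} 𝟙_H` is measurable. -/
theorem measurable_tiltWeight (hχ : Continuous χ) :
    Measurable fun x : Fin n → T3 => Real.exp (t * ∑ i, χ (x i)) * efR (Ov ε) x univ :=
  (measurable_const.mul (Finset.measurable_sum _ fun i _ =>
    hχ.measurable.comp (measurable_pi_apply i))).exp.mul (measurable_efR (measurableSet_ov ε) _)

/-- The tilted hard-core weight is bounded by `e^{|t| n C}`. -/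
theorem abs_tiltWeight_le {C : ℝ} (hχC : ∀ y, |χ y| ≤ C) (x : Fin n → T3) :
    |Real.exp (t * ∑ i, χ (x i)) * efR (Ov ε) x univ| ≤ Real.exp (|t| * (n * C)) := by
  rw [abs_mul, abs_of_pos (Real.exp_pos _)]
  have hS : |t * ∑ i, χ (x i)| ≤ |t| * (n * C) := by
    rw [abs_mul]
    exact mul_le_mul_of_nonneg_left (abs_sum_apply_le hχC x) (abs_nonneg t)
  calc Real.exp (t * ∑ i, χ (x i)) * |efR (Ov ε) x univ| ≤ Real.exp (|t| * (n * C)) * 1 :=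
        mul_le_mul (Real.exp_le_exp.2 ((le_abs_self _).trans hS)) (abs_efR_le_one x _)
          (abs_nonneg _) (Real.exp_pos _).le
    _ = _ := mul_one _

variable [NeZero n]

/-- **Tilted decorated partition function**: `Z_tⁿ M^χ_Q(n) = ∫ χ(x₀) e^{tS} 𝟙_H dμ_P^{⊗n}`. -/
theorem pow_mul_Md_tilt (hχ : Continuous χ)
    (hQ : ∀ x, Q.β x = P.β x * Real.exp (t * χ x) / ∫ y, P.β y * Real.exp (t * χ y)) :
    (∫ y, P.β y * Real.exp (t * χ y)) ^ n * Md Q ε n χ n =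
      ∫ x, χ (x 0) * (Real.exp (t * ∑ i, χ (x i)) * efR (Ov ε) x univ) ∂Measure.pi fun _ : Fin n => P.μ := by
  have hZ : 0 < ∫ y, P.β y * Real.exp (t * χ y) :=
    integral_pos_of_continuous_pos (P.continuous.mul (Real.continuous_exp.comp (continuous_const.mul hχ)))
      (fun y => mul_pos (P.pos y) (Real.exp_pos _))
  rw [Md, firstLabels_self, decPF, integral_pi_μ, integral_pi_μ]
  have h1 : ∀ y : Fin n → T3, (∏ i, Q.β (y i)) * (χ (y 0) * efR (Ov ε) y univ) =
      ((∫ y, P.β y * Real.exp (t * χ y)) ^ n)⁻¹ *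
        ((∏ i, P.β (y i)) * (χ (y 0) * (Real.exp (t * ∑ i, χ (y i)) * efR (Ov ε) y univ))) := by
    intro y; rw [prod_tilt_eq hQ]; ring
  simp_rw [h1]
  rw [integral_const_mul, ← mul_assoc, mul_inv_cancel₀ (pow_ne_zero n hZ.ne'), one_mul]

/-- **Exchangeability**: `∫ S e^{tS} 𝟙_H dμ_P^{⊗n} = n ∫ χ(x₀) e^{tS} 𝟙_H dμ_P^{⊗n}` for
`S = ∑ᵢ χ(xᵢ)` (relabelling invariance of the product law, of `S` and of the hard-core set). -/
theorem integral_sum_mul_tiltWeight (hχ : Continuous χ) {C : ℝ} (hχC : ∀ y, |χ y| ≤ C) :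
    ∫ x, (∑ i, χ (x i)) * (Real.exp (t * ∑ i, χ (x i)) * efR (Ov ε) x univ) ∂Measure.pi (fun _ : Fin n => P.μ) =
      n * ∫ x, χ (x 0) * (Real.exp (t * ∑ i, χ (x i)) * efR (Ov ε) x univ) ∂Measure.pi (fun _ : Fin n => P.μ) := by
  set W : (Fin n → T3) → ℝ := fun x => Real.exp (t * ∑ i, χ (x i)) * efR (Ov ε) x univ with hW
  have hWm : Measurable W := measurable_tiltWeight ε hχ
  have hC : 0 ≤ C := (abs_nonneg _).trans (hχC 0)
  have hint : ∀ i : Fin n, Integrable (fun x => χ (x i) * W x) (Measure.pi fun _ : Fin n => P.μ) := by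
    intro i
    refine integrable_pi_of_bounded P.μ ((hχ.measurable.comp (measurable_pi_apply i)).mul hWm)
      (C := C * Real.exp (|t| * (n * C))) fun x => ?_
    rw [abs_mul]
    exact mul_le_mul (hχC _) (abs_tiltWeight_le ε hχC x) (abs_nonneg _) hC
  simp_rw [sum_mul]
  rw [integral_finsetSum _ fun i _ => hint i]
  have hterm : ∀ i : Fin n, ∫ x, χ (x i) * W x ∂Measure.pi (fun _ : Fin n => P.μ) =
      ∫ x, χ (x 0) * W x ∂Measure.pi (fun _ : Fin n => P.μ) := by
    intro i
    have hF : AEStronglyMeasurable (fun x : Fin n → T3 => χ (x 0) * W x) (Measure.pi fun _ : Fin n => P.μ) :=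
      ((hχ.measurable.comp (measurable_pi_apply 0)).mul hWm).aestronglyMeasurable
    rw [← integral_comp_perm P.μ (Equiv.swap 0 i) hF]
    refine integral_congr_ae (ae_of_all _ fun x => ?_)
    dsimp only
    rw [Equiv.swap_apply_left, hW]
    dsimp only
    rw [efR_comp_perm (Equiv.swap 0 i) x univ, Finset.univ_map_equiv_to_embedding,
      Equiv.sum_comp (Equiv.swap 0 i) (fun j => χ (x j))]
  rw [Finset.sum_congr rfl fun i _ => hterm i, sum_const, card_univ, Fintype.card_fin, nsmul_eq_mul]

end TiltIdentity

/-! ### The Gibbs inequality and the one-sided exponential Chebyshev bound -/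

section Chernoff

/-- **Gibbs' inequality** (from `e^y ≥ 1 + y`): for a finite measure `ρ` and a bounded measurable
`f`, `∫ e^f dρ ≤ ρ(univ) · exp(∫ f e^f dρ / ∫ e^f dρ)` — the log-Laplace transform is bounded by
the tilted mean. -/
theorem integral_exp_le {α : Type*} [MeasurableSpace α] (ρ : Measure α) [IsFiniteMeasure ρ]
    {f : α → ℝ} (hf : Measurable f) {K : ℝ} (hfK : ∀ x, |f x| ≤ K) :
    ∫ x, Real.exp (f x) ∂ρ ≤
      ρ.real univ * Real.exp ((∫ x, f x * Real.exp (f x) ∂ρ) / ∫ x, Real.exp (f x) ∂ρ) := by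
  set A := ∫ x, Real.exp (f x) ∂ρ with hA
  set B := ∫ x, f x * Real.exp (f x) ∂ρ with hB
  have hexpK : ∀ x, Real.exp (f x) ≤ Real.exp K := fun x =>
    Real.exp_le_exp.2 ((le_abs_self _).trans (hfK x))
  have hexp_int : Integrable (fun x => Real.exp (f x)) ρ :=
    (integrable_const (Real.exp K)).mono' hf.exp.aestronglyMeasurable
      (ae_of_all _ fun x => by rw [Real.norm_eq_abs, abs_of_pos (Real.exp_pos _)]; exact hexpK x)
  have hfexp_int : Integrable (fun x => f x * Real.exp (f x)) ρ :=
    (integrable_const (K * Real.exp K)).mono' (hf.mul hf.exp).aestronglyMeasurable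
      (ae_of_all _ fun x => by
        rw [Real.norm_eq_abs, abs_mul, abs_of_pos (Real.exp_pos _)]
        exact mul_le_mul (hfK x) (hexpK x) (Real.exp_pos _).le ((abs_nonneg _).trans (hfK x)))
  by_cases hA0 : A = 0
  · rw [hA0]; exact mul_nonneg measureReal_nonneg (Real.exp_pos _).le
  set m := B / A with hm
  have hpt : ∀ x, Real.exp (f x) + (m * Real.exp (f x) - f x * Real.exp (f x)) ≤ Real.exp m := by
    intro x
    have h := Real.add_one_le_exp (m - f x)
    have h2 : Real.exp (f x) * Real.exp (m - f x) = Real.exp m := by rw [← Real.exp_add]; ring_nf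
    nlinarith [Real.exp_pos (f x)]
  have hg : Integrable (fun x => m * Real.exp (f x) - f x * Real.exp (f x)) ρ :=
    (hexp_int.const_mul m).sub hfexp_int
  have hI : ∫ x, (Real.exp (f x) + (m * Real.exp (f x) - f x * Real.exp (f x))) ∂ρ ≤ ∫ _x, Real.exp m ∂ρ :=
    integral_mono (hexp_int.add hg) (integrable_const _) hpt
  rw [integral_add hexp_int hg, integral_sub (hexp_int.const_mul m) hfexp_int, integral_const_mul,
    integral_const, smul_eq_mul] at hI
  have hmA : m * A = B := by rw [hm]; field_simp
  rw [← hA, ← hB] at hI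
  linarith

variable {P Q : DensityProfile} {χ : T3 → ℝ} {t : ℝ} (ε : ℝ) {n : ℕ} [NeZero n]

omit [NeZero n] in
/-- Integrals against the hard-core restricted product law are `efR`-weighted integrals. -/
theorem integral_restrict_hardCore (g : (Fin n → T3) → ℝ) :
    ∫ x, g x ∂(Measure.pi fun _ : Fin n => P.μ).restrict (hardCoreSet (Ov ε) univ) =
      ∫ x, g x * efR (Ov ε) x univ ∂Measure.pi fun _ : Fin n => P.μ := by
  rw [← integral_indicator (measurableSet_hardCoreSet (measurableSet_ov ε) _)]
  refine integral_congr_ae (ae_of_all _ fun x => ?_)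
  dsimp only
  rw [efR_eq_indicator]
  by_cases hx : x ∈ (hardCoreSet (Ov ε) (univ : Finset (Fin n)) : Set (Fin n → T3))
  · rw [Set.indicator_of_mem hx, Set.indicator_of_mem hx, Pi.one_apply, mul_one]
  · rw [Set.indicator_of_notMem hx, Set.indicator_of_notMem hx, mul_zero]

/-- **One-sided exponential Chebyshev bound for the canonical hard-sphere gas.** For `t > 0`,
continuous `|χ| ≤ C`, the `t`-tilted profile `Q` and any level `a`:
`Ξ_P(n)⁻¹ μ_P^{⊗n}|_H {n a ≤ ∑ χ(xᵢ)} ≤ exp(n t (M^χ_Q(n)/Ξ_Q(n) - a))` — Markov's inequality,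
Gibbs' inequality `log E e^{tS} ≤ t E_t[S]`, and the identification of the tilted law of the
positions with the canonical gas of the tilted profile. -/
theorem canonical_tail_le (hχ : Continuous χ) {C : ℝ} (hχC : ∀ y, |χ y| ≤ C)
    (hQ : ∀ x, Q.β x = P.β x * Real.exp (t * χ x) / ∫ y, P.β y * Real.exp (t * χ y))
    (ht : 0 < t) (hXi : 0 < Xi P ε n n) (a : ℝ) :
    (ENNReal.ofReal (Xi P ε n n)⁻¹ •
        (Measure.pi fun _ : Fin n => P.μ).restrict (hardCoreSet (Ov ε) univ))
        {x | (n : ℝ) * a ≤ ∑ i, χ (x i)} ≤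
      ENNReal.ofReal (Real.exp ((n : ℝ) * t * (Md Q ε n χ n / Xi Q ε n n - a))) := by
  set μP : Measure (Fin n → T3) := Measure.pi fun _ : Fin n => P.μ with hμP
  set ρ := μP.restrict (hardCoreSet (Ov ε) univ) with hρ
  set Z := ∫ y, P.β y * Real.exp (t * χ y) with hZdef
  set S : (Fin n → T3) → ℝ := fun x => ∑ i, χ (x i) with hS
  haveI : IsFiniteMeasure ρ := by rw [hρ]; infer_instance
  have hC : 0 ≤ C := (abs_nonneg _).trans (hχC 0)
  have hZ : 0 < Z :=
    integral_pos_of_continuous_pos (P.continuous.mul (Real.continuous_exp.comp (continuous_const.mul hχ)))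
      (fun y => mul_pos (P.pos y) (Real.exp_pos _))
  have hSm : Measurable S := Finset.measurable_sum _ fun i _ => hχ.measurable.comp (measurable_pi_apply i)
  have htSm : Measurable fun x => t * S x := measurable_const.mul hSm
  have htSK : ∀ x, |t * S x| ≤ |t| * (n * C) := fun x => by
    rw [abs_mul]; exact mul_le_mul_of_nonneg_left (abs_sum_apply_le hχC x) (abs_nonneg t)
  -- total mass and the two tilted integrals
  have hρuniv : ρ.real univ = Xi P ε n n := by
    rw [hρ, measureReal_restrict_apply_univ, Xi, firstLabels_self]; rfl
  have hA : ∫ x, Real.exp (t * S x) ∂ρ = Z ^ n * Xi Q ε n n := by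
    rw [hρ, integral_restrict_hardCore, pow_mul_Xi_tilt ε hχ hQ]
  have hB : ∫ x, (t * S x) * Real.exp (t * S x) ∂ρ = t * (n * (Z ^ n * Md Q ε n χ n)) := by
    rw [hρ, integral_restrict_hardCore, pow_mul_Md_tilt ε hχ hQ, ← integral_sum_mul_tiltWeight ε hχ hχC,
      ← integral_const_mul]
    refine integral_congr_ae (ae_of_all _ fun x => ?_)
    simp only [hS]; ring
  have hZn : Z ^ n ≠ 0 := pow_ne_zero n hZ.ne'
  have hXiQ : 0 < Xi Q ε n n := by
    -- `Z^n Ξ_Q = ∫ e^{tS} dρ > 0` since `ρ ≠ 0`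
    have hApos : 0 < ∫ x, Real.exp (t * S x) ∂ρ := by
      have hne : NeZero ρ := ⟨fun h0 => by
        have : ρ.real univ = 0 := by rw [h0]; simp
        rw [hρuniv] at this; exact hXi.ne' this⟩
      exact integral_exp_pos ((integrable_const (Real.exp (|t| * (n * C)))).mono' htSm.exp.aestronglyMeasurable
        (ae_of_all _ fun x => by
          rw [Real.norm_eq_abs, abs_of_pos (Real.exp_pos _)]
          exact Real.exp_le_exp.2 ((le_abs_self _).trans (htSK x))))
    rw [hA] at hApos
    exact pos_of_mul_pos_right hApos (pow_nonneg hZ.le n)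
  have hexp_int : Integrable (fun x => Real.exp (t * S x)) ρ :=
    (integrable_const (Real.exp (|t| * (n * C)))).mono' htSm.exp.aestronglyMeasurable
      (ae_of_all _ fun x => by
        rw [Real.norm_eq_abs, abs_of_pos (Real.exp_pos _)]
        exact Real.exp_le_exp.2 ((le_abs_self _).trans (htSK x)))
  -- Gibbs' inequality on `ρ`
  have hGibbs := integral_exp_le ρ htSm htSK
  rw [hA, hB, hρuniv] at hGibbs
  have hratio : t * (n * (Z ^ n * Md Q ε n χ n)) / (Z ^ n * Xi Q ε n n) =
      (n : ℝ) * t * (Md Q ε n χ n / Xi Q ε n n) := by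
    field_simp
  rw [hratio] at hGibbs
  -- Markov's inequality on `ρ`
  have hMarkov := mul_meas_ge_le_integral_of_nonneg (μ := ρ) (ae_of_all _ fun x => (Real.exp_pos (t * S x)).le)
    hexp_int (Real.exp (t * (n * a)))
  have hset : {x : Fin n → T3 | (n : ℝ) * a ≤ ∑ i, χ (x i)} =
      {x | Real.exp (t * (n * a)) ≤ Real.exp (t * S x)} := by
    ext x
    simp only [Set.mem_setOf_eq, Real.exp_le_exp, hS]
    exact (mul_le_mul_iff_of_pos_left ht).symm
  have hreal : ρ.real {x | (n : ℝ) * a ≤ ∑ i, χ (x i)} ≤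
      Xi P ε n n * Real.exp ((n : ℝ) * t * (Md Q ε n χ n / Xi Q ε n n - a)) := by
    rw [hset]
    have hpos : 0 < Real.exp (t * (n * a)) := Real.exp_pos _
    refine le_of_mul_le_mul_left ?_ hpos
    calc Real.exp (t * (n * a)) * ρ.real {x | Real.exp (t * (n * a)) ≤ Real.exp (t * S x)}
        ≤ ∫ x, Real.exp (t * S x) ∂ρ := hMarkov
      _ = Z ^ n * Xi Q ε n n := hA
      _ ≤ Xi P ε n n * Real.exp ((n : ℝ) * t * (Md Q ε n χ n / Xi Q ε n n)) := hGibbs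
      _ = Real.exp (t * (n * a)) * (Xi P ε n n * Real.exp ((n : ℝ) * t * (Md Q ε n χ n / Xi Q ε n n - a))) := by
          rw [mul_left_comm, ← Real.exp_add]; ring_nf
  -- to `ℝ≥0∞`
  rw [Measure.smul_apply, smul_eq_mul, ← ofReal_measureReal (measure_ne_top ρ _),
    ← ENNReal.ofReal_mul (inv_nonneg.2 hXi.le)]
  refine ENNReal.ofReal_le_ofReal ?_
  calc (Xi P ε n n)⁻¹ * ρ.real {x | (n : ℝ) * a ≤ ∑ i, χ (x i)}
      ≤ (Xi P ε n n)⁻¹ * (Xi P ε n n * Real.exp ((n : ℝ) * t * (Md Q ε n χ n / Xi Q ε n n - a))) :=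
        mul_le_mul_of_nonneg_left hreal (inv_nonneg.2 hXi.le)
    _ = _ := by rw [← mul_assoc, inv_mul_cancel₀ hXi.ne', one_mul]

end Chernoff


end UniformLGC

end Summit.AtomisticToContinuum.HydrodynamicLimit.Theorems

end
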